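import Literature.MathematicalPhysics.QuantumFieldTheory.Balaban1983to89.B7AvgPeriodicity
import Literature.MathematicalPhysics.QuantumFieldTheory.Balaban1983to89.B7Eq92Concrete
import Literature.MathematicalPhysics.QuantumFieldTheory.Balaban1983to89.T4TermwiseTorus
import Literature.MathematicalPhysics.QuantumFieldTheory.Balaban1983to89.TorusGeometry
import Literature.MathematicalPhysics.QuantumFieldTheory.Balaban1983to89.T3ContinuumYM3Torus
import HarnessLib

/-!
# Route `UnitScaleTilt`, crux K1 child «MinimiserStabilityRegPr» (stmt-QuantumFields-19200), (β)-lane ∕ (n3)-comb (II), file **F-8a «PERIOD-CELL DICTIONARY»**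
# (★routeR-w1 g9 MASTER `DESIGN-N3COMB-LINEAR-CORE` §2 (R5) W1 «everything on ℤ³, one period cell»; pen w8-19200 g10 on ★routeR-w1 g9's word 2026-08-29T07:35Z)

Cell `ym3-torus` (HUMAN RULING D-0037: YM₃ on T³ is ladder rung R3 — NOT d = 4, NOT infinite volume, NOT a mass gap, NOT the Clay problem).  Width seat `ym-ust-19200-w8`
gen 10.  `--supports stmt-QuantumFields-19200 --as helper`; THEOREMS ONLY (0 `def`, 0 `sorry`); Mathlib + `Literature` imports only (no (II) dependency); count-neutral.

WHAT (pure bookkeeping for the (II) supplier, which is stated for PERIODIC fields on `ℤᵈ` with every `ℓ²` sum over ONE PERIOD CELL of the relevant level):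
* §1 PERIODICITY THROUGH THE LEVELS for the tilde tower (69) `Ũʲ = tildIter L U₀ U₁ j`: the bridge `isPeriodic_iff_shiftCfg` between the torus-lane predicate
  `T4TermwiseTorus.IsPeriodic T F` («`F (x + T•m) = F x` for all `m`») and the lit letter `shiftCfg (T • a) F = F`; ★`tildIter_periodic` — the twin of lit
  ✓`B7AvgPeriodicity.avgIter_periodic` («`U₀, U₁` `LʲT`-periodic ⇒ `Ũʲ` `T`-periodic», translation covariance ✓`B7TranslationCovariance.avgIter_shiftCfg`) and its coordinate-direction
  reading `tildIter_periodic_coord` (the letter of lit ✓`B8Eq166ConstraintPair.avgIter_periodic`: `t_{N·Lᵏe_i}`-invariant data ⇒ `Ũʲ` `t_{N·L^{k−j}e_i}`-invariant, `j ≤ k`); ★`isPeriodic_tildIter` ∕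
  ★`isPeriodic_tildIter_le` (the `IsPeriodic` readings: `N·Lʲ`-periodic data ⇒ `Ũʲ` `N`-periodic; `N·Lᵏ`-periodic data ⇒ `Ũʲ` `N·L^{k−j}`-periodic for `j ≤ k`); `isPeriodic_avgIter`,
  `isPeriodic_mul`.  The pointwise shift form `tildIter L (t_{Lʲa}U₀) (t_{Lʲa}U₁) j z = tildIter L U₀ U₁ j (z + a)` is ALREADY ✓`Prop7ChartSigmaT3Descent.tildIter_shiftCfg` — cited, not restated.
* §2 A TORUS SUM IS A SUM OVER ONE PERIOD CELL, in SIGNATURE-0's letters: ★`sum_site_eq_sum_box` (`Σ_{z : Site P l} f (tlift z) = Σ_{x ∈ box N_l} f x`, `tlift z = fun μ ↦ ((z μ).val : ℤ)`),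
  `sum_box_eq_sum_boxVec` (`Σ_{x ∈ box N} f x = Σ_{t : Fin d → Fin N} f (boxVec N t)`), ★`sum_site_eq_sum_boxVec` (both, for any `N = P.sitesPerDir l`).  (The based form
  `Σ_x f x = Σ_{z ∈ box} f (y + z)` is ✓`Prop7LandauCombDict.sum_univ_eq_sum_box_transl`; here `y = 0` and the summand lives on `ℤᵈ`.)
* §3 THE T³ NUMERALS by name: `sitesPerDir_T3` (`(F.P K).sitesPerDir l = 2·F.L^{F.m+K−l}`), `sitesPerDir_T3_eq_mul_succ` (`= F.L · sitesPerDir (l+1)` for `l < F.m + K`; lit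
  ✓`Params.sitesPerDir_eq_mul_succ`), `sitesPerDir_T3_mul_pow` (`sitesPerDir l · F.Lˡ = sitesPerDir 0`, `l ≤ F.m + K`), and the member reading ★★`isPeriodic_tildIter_T3`
  (`U₀, U₁` `N₀ := (F.P K).sitesPerDir 0`-periodic — e.g. ✓`Prop7LandauCombDict.isPeriodic_pull` — ⇒ `Ũˡ` is `N_l := (F.P K).sitesPerDir l`-periodic for every `l ≤ F.m + K`).
HONEST SCOPE: re-indexing only; no estimate; nothing of `hMcomb`∕`hMcomb₂`∕(β)∕EX `stub_existenceMinimalOrbit`∕the crux is proved or claimed; YM gap NOT proved.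
References: T. Bałaban, CMP **98** (1985) 17–51 [Balaban1985Averaging] ((43) p.24, (69) p.29, p.19 «Ω^{(j)} may be replaced by any other lattice»); CMP **109** (1987) 249–301
[Balaban1987RG1] ((0.1) p.251, (4.16) p.285); CMP **99** (1985) 75–102 [Balaban1985RegularSpaces] (p.77 «Ω_j = T_η», (1.3)).
-/

set_option autoImplicit false

noncomputable section

open scoped BigOperators

namespace Summit.QuantumFields.YangMills.Theorems.Prop7CombPeriodCellDict

open Literature.MathematicalPhysics.QuantumFieldTheory.Balaban1983to89
open Literature.MathematicalPhysics.QuantumFieldTheory.Balaban1983to89.T3ContinuumYM3Torus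
open B7Prop1Explicit renaming Site → LSite
open B7Prop1Explicit (e boxVec)
open B7Prop2Explicit (avgIter)
open B7Eq92Concrete (tildIter tildIter_apply)
open B12Ineq417Flat (shiftCfg shiftCfg_apply)
open B7TranslationCovariance (avgIter_shiftCfg shiftCfg_mul)
open B7AvgPeriodicity (avgIter_periodic periodic_of_coord)
open T4TermwiseTorus (IsPeriodic box tcls tlift tlift_mem_box tlift_tcls_of_mem_box tcls_tlift boxVec_injective)

/-! ## §1 Periodicity through the levels for the tilde tower (69) -/

section Periodic

variable {d : ℕ}

/-- The torus-lane predicate `IsPeriodic T F` (`F (x + T•m) = F x` for every lattice vector `m`) is invariance under every translation `t_{T•a}` in the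
lit letter `shiftCfg`. [cite: Balaban1987RG1, (0.1) p.251, (4.16) p.285] -/
theorem isPeriodic_iff_shiftCfg {β : Type*} (T : ℕ) (F : LSite d → β) :
    IsPeriodic T F ↔ ∀ a : LSite d, shiftCfg ((T : ℤ) • a) F = F := by
  constructor
  · intro h a; funext x; exact h x a
  · intro h x m; exact congrFun (h m) x

/-- `IsPeriodic` in the `shiftCfg` letter (forward direction, the form the lit lemmas consume). [cite: Balaban1987RG1, (0.1) p.251] -/
theorem shiftCfg_eq_of_isPeriodic {β : Type*} {T : ℕ} {F : LSite d → β} (h : IsPeriodic T F) (a : LSite d) :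
    shiftCfg ((T : ℤ) • a) F = F :=
  (isPeriodic_iff_shiftCfg T F).1 h a

/-- The pointwise product of two `T`-periodic bond configurations is `T`-periodic. [cite: Balaban1985Averaging, (69) p.29] -/
theorem isPeriodic_mul {G : Type*} [Mul G] {T : ℕ} {V W : LSite d → Fin d → G} (hV : IsPeriodic T V) (hW : IsPeriodic T W) :
    IsPeriodic T (V * W) := fun x m => by
  show V (x + (T : ℤ) • m) * W (x + (T : ℤ) • m) = V x * W x
  rw [hV x m, hW x m]

variable {𝔸 : Type*} [NormedRing 𝔸] [NormedAlgebra ℂ 𝔸] [CompleteSpace 𝔸]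

/-- ★ **THE TILDE TOWER (69) OF `LʲT`-PERIODIC DATA IS `T`-PERIODIC ON THE `j`-TH LATTICE** — the twin of lit ✓`B7AvgPeriodicity.avgIter_periodic` for
`Ũʲ = \overline{(U₁U₀)}ʲ·(Ū₀ʲ)⁻¹` (translation covariance of (43)). [cite: Balaban1985Averaging, (69) p.29, (43) p.24; Balaban1987RG1, (0.1) p.251] -/
theorem tildIter_periodic (L : ℕ) (U₀ U₁ : LSite d → Fin d → 𝔸ˣ) (j : ℕ) {T : ℤ}
    (hU₀ : ∀ a : LSite d, shiftCfg ((((L : ℤ) ^ j) * T) • a) U₀ = U₀) (hU₁ : ∀ a : LSite d, shiftCfg ((((L : ℤ) ^ j) * T) • a) U₁ = U₁)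
    (a : LSite d) : shiftCfg (T • a) (tildIter L U₀ U₁ j) = tildIter L U₀ U₁ j := by
  have h10 : ∀ a : LSite d, shiftCfg ((((L : ℤ) ^ j) * T) • a) (U₁ * U₀) = U₁ * U₀ := fun a => by
    rw [shiftCfg_mul, hU₁ a, hU₀ a]
  funext z κ
  rw [shiftCfg_apply, tildIter_apply, tildIter_apply, ← shiftCfg_apply (T • a) (avgIter L (U₁ * U₀) j) z,
    ← shiftCfg_apply (T • a) (avgIter L U₀ j) z, avgIter_periodic L (U₁ * U₀) j h10 a, avgIter_periodic L U₀ j hU₀ a]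

/-- The coordinate-direction form (the letter of lit ✓`B8Eq166ConstraintPair.avgIter_periodic`): `U₀, U₁` invariant under `t_{N·Lᵏ·e_i}` for every `i` ⇒ `Ũʲ` invariant under
`t_{N·L^{k−j}·e_i}` for every `j ≤ k` and `i` (via lit ✓`B7AvgPeriodicity.periodic_of_coord`). [cite: Balaban1985Averaging, (69) p.29, (43) p.24; Balaban1987RG1, (0.1) p.251] -/
theorem tildIter_periodic_coord (L N k : ℕ) {U₀ U₁ : LSite d → Fin d → 𝔸ˣ}
    (hU₀ : ∀ i : Fin d, shiftCfg (((N * L ^ k : ℕ) : ℤ) • e i) U₀ = U₀) (hU₁ : ∀ i : Fin d, shiftCfg (((N * L ^ k : ℕ) : ℤ) • e i) U₁ = U₁) :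
    ∀ j ≤ k, ∀ i : Fin d, shiftCfg (((N * L ^ (k - j) : ℕ) : ℤ) • e i) (tildIter L U₀ U₁ j) = tildIter L U₀ U₁ j := by
  intro j hj i
  have hc : (((N * L ^ k : ℕ) : ℤ)) = ((L : ℤ) ^ j) * (((N * L ^ (k - j) : ℕ) : ℤ)) := by
    push_cast
    rw [mul_left_comm, ← pow_add, Nat.add_sub_cancel' hj]
  have h₀ := periodic_of_coord hU₀
  have h₁ := periodic_of_coord hU₁
  rw [hc] at h₀ h₁
  exact tildIter_periodic L U₀ U₁ j h₀ h₁ (e i)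

/-- The `j`-fold average (43) of an `N·Lʲ`-periodic configuration is `N`-periodic (`IsPeriodic` reading of lit ✓`avgIter_periodic`).
[cite: Balaban1985Averaging, (43) p.24; Balaban1987RG1, (0.1) p.251] -/
theorem isPeriodic_avgIter (L N : ℕ) {U : LSite d → Fin d → 𝔸ˣ} (j : ℕ) (hU : IsPeriodic (N * L ^ j) U) : IsPeriodic N (avgIter L U j) := by
  rw [isPeriodic_iff_shiftCfg]
  intro a
  refine avgIter_periodic L U j (T := (N : ℤ)) (fun b => ?_) a
  have h := shiftCfg_eq_of_isPeriodic hU b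
  rwa [show (((N * L ^ j : ℕ) : ℤ)) = ((L : ℤ) ^ j) * (N : ℤ) by push_cast; ring] at h

/-- ★ **`N·Lʲ`-PERIODIC DATA ⇒ `Ũʲ` IS `N`-PERIODIC** (`IsPeriodic` reading of `tildIter_periodic`). [cite: Balaban1985Averaging, (69) p.29, (43) p.24] -/
theorem isPeriodic_tildIter (L N : ℕ) {U₀ U₁ : LSite d → Fin d → 𝔸ˣ} (j : ℕ) (hU₀ : IsPeriodic (N * L ^ j) U₀) (hU₁ : IsPeriodic (N * L ^ j) U₁) :
    IsPeriodic N (tildIter L U₀ U₁ j) := by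
  rw [isPeriodic_iff_shiftCfg]
  intro a
  have hc : (((N * L ^ j : ℕ) : ℤ)) = ((L : ℤ) ^ j) * (N : ℤ) := by push_cast; ring
  refine tildIter_periodic L U₀ U₁ j (T := (N : ℤ)) (fun b => ?_) (fun b => ?_) a
  · have h := shiftCfg_eq_of_isPeriodic hU₀ b; rwa [hc] at h
  · have h := shiftCfg_eq_of_isPeriodic hU₁ b; rwa [hc] at h

/-- ★ **THE TOWER**: `N·Lᵏ`-periodic data ⇒ `Ũʲ` is `N·L^{k−j}`-periodic for every `j ≤ k` (the shape of lit ✓`B8Eq166ConstraintPair.avgIter_periodic`).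
[cite: Balaban1985Averaging, (69) p.29, (43) p.24; Balaban1987RG1, (0.1) p.251] -/
theorem isPeriodic_tildIter_le (L N k : ℕ) {U₀ U₁ : LSite d → Fin d → 𝔸ˣ} (hU₀ : IsPeriodic (N * L ^ k) U₀) (hU₁ : IsPeriodic (N * L ^ k) U₁)
    {j : ℕ} (hj : j ≤ k) : IsPeriodic (N * L ^ (k - j)) (tildIter L U₀ U₁ j) := by
  have hk : N * L ^ k = (N * L ^ (k - j)) * L ^ j := by
    rw [mul_assoc, ← pow_add, Nat.sub_add_cancel hj]
  rw [hk] at hU₀ hU₁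
  exact isPeriodic_tildIter L (N * L ^ (k - j)) j hU₀ hU₁

/-- Pointwise form of `isPeriodic_tildIter_le`: `Ũʲ(z + N·L^{k−j}·m) = Ũʲ(z)`. [cite: Balaban1985Averaging, (69) p.29] -/
theorem tildIter_add_period (L N k : ℕ) {U₀ U₁ : LSite d → Fin d → 𝔸ˣ} (hU₀ : IsPeriodic (N * L ^ k) U₀) (hU₁ : IsPeriodic (N * L ^ k) U₁)
    {j : ℕ} (hj : j ≤ k) (z m : LSite d) (κ : Fin d) :
    tildIter L U₀ U₁ j (z + ((N * L ^ (k - j) : ℕ) : ℤ) • m) κ = tildIter L U₀ U₁ j z κ := by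
  rw [isPeriodic_tildIter_le L N k hU₀ hU₁ hj z m]

end Periodic

/-! ## §2 A torus sum is a sum over one period cell (SIGNATURE-0's index set) -/

section Cell

variable {d : ℕ}

/-- The box `[0,N)ᵈ ⊂ ℤᵈ` is the injective image of `Fin d → Fin N` under `boxVec`: `Σ_{x ∈ box N} f x = Σ_{t} f (boxVec N t)`. [cite: Balaban1987RG1, (0.1) p.251] -/
theorem sum_box_eq_sum_boxVec {M : Type*} [AddCommMonoid M] (N : ℕ) (f : LSite d → M) :
    ∑ x ∈ box (d := d) N, f x = ∑ t : Fin d → Fin N, f (boxVec N t) := by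
  classical
  rw [box, Finset.sum_image fun r _ r' _ h => boxVec_injective N h]

variable {P : Params} {l : ℕ}

/-- ★ **A TORUS SUM IS A SUM OVER ONE PERIOD CELL**: `Σ_{z : Site P l} f (tlift z) = Σ_{x ∈ [0,N_l)ᵈ} f x`, `N_l = P.sitesPerDir l` (`tlift` is a bijection onto the box).
[cite: Balaban1985RegularSpaces, p.77; Balaban1987RG1, (0.1) p.251] -/
theorem sum_site_eq_sum_box {M : Type*} [AddCommMonoid M] (f : LSite P.d → M) :
    ∑ z : Site P l, f (tlift z) = ∑ x ∈ box (d := P.d) (P.sitesPerDir l), f x := by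
  classical
  exact Finset.sum_nbij' (fun z => tlift z) (fun x => tcls (P.sitesPerDir l) x) (fun z _ => tlift_mem_box z) (fun _ _ => Finset.mem_univ _)
    (fun z _ => tcls_tlift z) (fun x hx => tlift_tcls_of_mem_box hx) (fun _ _ => rfl)

/-- ★ **THE SAME, INDEXED BY `Fin d → Fin N`** for any name `N` of the site count: `Σ_{z : Site P l} f (tlift z) = Σ_{t : Fin d → Fin N} f (boxVec N t)`.
[cite: Balaban1985RegularSpaces, p.77; Balaban1987RG1, (0.1) p.251] -/
theorem sum_site_eq_sum_boxVec {M : Type*} [AddCommMonoid M] {N : ℕ} (hN : P.sitesPerDir l = N) (f : LSite P.d → M) :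
    ∑ z : Site P l, f (tlift z) = ∑ t : Fin P.d → Fin N, f (boxVec N t) := by
  subst hN
  rw [sum_site_eq_sum_box, sum_box_eq_sum_boxVec]

end Cell

/-! ## §3 The T³ numerals and the member reading -/

section T3

variable (F : T3Family)

/-- `N_l = 2·L^{m+K−l}`: the site count of the level-`l` torus of member `K`. [cite: Balaban1985RegularSpaces, p.77 («Ω_j = T_η»)] -/
theorem sitesPerDir_T3 (K l : ℕ) : (F.P K).sitesPerDir l = 2 * F.L ^ (F.m + K - l) := rfl

/-- `N_l = L · N_{l+1}` for `l < m + K` (lit ✓`Params.sitesPerDir_eq_mul_succ`). [cite: Balaban1987RG1, (0.1) p.251] -/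
theorem sitesPerDir_T3_eq_mul_succ (K : ℕ) {l : ℕ} (hl : l < F.m + K) : (F.P K).sitesPerDir l = F.L * (F.P K).sitesPerDir (l + 1) := by
  rw [(F.P K).sitesPerDir_eq_mul_succ (j := l) (show l + 1 ≤ (F.P K).m + (F.P K).K from hl), mul_comm]; rfl

/-- `N_l · Lˡ = N₀` for `l ≤ m + K`: the level-`l` lattice divides the finest torus. [cite: Balaban1985RegularSpaces, p.77] -/
theorem sitesPerDir_T3_mul_pow (K : ℕ) {l : ℕ} (hl : l ≤ F.m + K) : (F.P K).sitesPerDir l * F.L ^ l = (F.P K).sitesPerDir 0 := by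
  rw [sitesPerDir_T3, sitesPerDir_T3, Nat.sub_zero, mul_assoc, ← pow_add, Nat.sub_add_cancel hl]

variable {𝔸 : Type*} [NormedRing 𝔸] [NormedAlgebra ℂ 𝔸] [CompleteSpace 𝔸]

/-- ★★ **THE MEMBER READING**: for `N₀ := (F.P K).sitesPerDir 0`-periodic backgrounds `U₀, U₁` on `ℤ³` (e.g. based pullbacks of torus fields, ✓`Prop7LandauCombDict.isPeriodic_pull`),
the tilde tower `Ũˡ = tildIter F.L U₀ U₁ l` is `N_l := (F.P K).sitesPerDir l`-periodic for every level `l ≤ F.m + K` — so every `ℓ²` sum over the level-`l` torus is a sum over ONE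
period cell `[0, N_l)³` (§2). [cite: Balaban1985Averaging, (69) p.29, (43) p.24; Balaban1985RegularSpaces, p.77] -/
theorem isPeriodic_tildIter_T3 (K : ℕ) {U₀ U₁ : LSite (F.P K).d → Fin (F.P K).d → 𝔸ˣ}
    (hU₀ : IsPeriodic ((F.P K).sitesPerDir 0) U₀) (hU₁ : IsPeriodic ((F.P K).sitesPerDir 0) U₁) {l : ℕ} (hl : l ≤ F.m + K) :
    IsPeriodic ((F.P K).sitesPerDir l) (tildIter F.L U₀ U₁ l) := by
  rw [← sitesPerDir_T3_mul_pow F K hl] at hU₀ hU₁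
  exact isPeriodic_tildIter F.L ((F.P K).sitesPerDir l) l hU₀ hU₁

end T3

end Summit.QuantumFields.YangMills.Theorems.Prop7CombPeriodCellDict

end
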